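import Literature.Analysis.Convexity.UnitBallNets
import Mathlib.Analysis.InnerProductSpace.Continuous
import Mathlib.Probability.Moments.SubGaussian
import Mathlib.MeasureTheory.Function.L2Space
import Mathlib.MeasureTheory.Measure.Real
import HarnessLib

/-!
# The largest eigenvalue of `W Wᵀ` for independent columns: Micciancio–Regev 2007, Lemma 5.20

Topic `Probability/Moments`, companion of `IndependentVectorSums.lean` (MR07 Lemma 2.11). A fully
PROVED rendering, in Mathlib's language (`iIndepFun`, Bochner expectations, Hoeffding's inequality
`ProbabilityTheory.HasSubgaussianMGF.measure_sum_ge_le_of_iIndepFun`), of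

**Micciancio–Regev 2007, Lemma 5.20** (authors' version p. 27; = Aharonov–Regev 2005, Lemma 6.2;
proof reproduced in MR07 App. A, pp. 33–34): *Let `σ, K, ℓ > 0` and let `D` be a distribution on
`ℝⁿ` such that `E[⟨u, w⟩²] ≤ ℓ²` for every unit vector `u` and `Pr[‖w‖ ≥ Kℓ] ≤ σ`. If the columns of
`W = [w₁, …, w_N]` are drawn independently from `D`, then with probability at least
`1 - e^{-N/K⁴} (4√n K²)ⁿ - Nσ` the largest eigenvalue of `W Wᵀ` is at most `3Nℓ²`.*

This is the tool behind test (c) of the verifier in the proof of MR07 Thm. 5.23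
(`Literature.Computability.Cryptography.MicciancioRegev2007_gapCVP'_to_SIS'`, authors' version
p. 30: `ℓ = 2sβ`, `N = n³m³`, `K = nm`), for which this file was written; it is independent of lattices.

## Statement as formalised

* The `wᵢ : Ω → V` (`i : ι`, `N = #ι`) are independent (`iIndepFun`) random vectors with finite
  second moments (`MemLp (w i) 2 P`, tacit in print) in a finite-dimensional real inner product
  space `V`, `n = finrank ℝ V`; identical distribution is NOT assumed — only the two per-sample
  bounds `E⟨u, wᵢ⟩² ≤ ℓ²` (unit `u`) and `Pr[Kℓ ≤ ‖wᵢ‖] ≤ σ` are used, as in the printed proof.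
* "largest eigenvalue of `W Wᵀ` at most `3Nℓ²`" is the quadratic-form statement
  `∑ᵢ ⟨u, wᵢ⟩² ≤ 3Nℓ²‖u‖²` for all `u` (App. A, first display: "if and only if
  `N⁻¹ ∑ᵢ ⟨u, wᵢ⟩² ≤ 3ℓ²` for all unit vectors `u`"), the form consumed by
  `Literature.Algebra.EuclideanLattices.half_le_sum_cos_div_card_of_norm_sub_le` (MR07 verifier).
* The conclusion bounds the (outer) probability `P.real` of the failure event
  `{ω | ∃ u, 3Nℓ²‖u‖² < ∑ᵢ ⟨u, wᵢ ω⟩²}` by `e^{-N/K⁴}(4√n K²)ⁿ + Nσ`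
  (`MicciancioRegev2007.measureReal_exists_lt_sum_inner_sq_le`); no measurability of that event
  is needed, and the complementary form `1 - … ≤ P.real {ω | ∀ u, …}` follows by subadditivity
  (`MicciancioRegev2007.one_sub_le_measureReal_forall_sum_inner_sq_le`).

## Proof (as printed, App. A)

Truncate `ξ(x) = x` if `‖x‖ ≤ Kℓ`, else `0` (Mathlib: the indicator of the closed ball). For a
fixed `u` of norm `≤ 1` the variables `⟨u, ξ(wᵢ)⟩² ∈ [0, (Kℓ)²]` are independent with mean
`≤ E⟨u, wᵢ⟩² ≤ ℓ²`, so Hoeffding gives `Pr[∑ᵢ ⟨u, ξ(wᵢ)⟩² > 2Nℓ²] ≤ e^{-2N/K⁴}`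
(`measureReal_lt_sum_inner_indicator_sq_le`; print: `e^{-N/K⁴}`). Union bound over an `ε`-net `A`
of the unit ball, `ε = 1/(2K²)`, `#A ≤ (4√n K²)ⁿ`
(`Literature.Analysis.Convexity.exists_net_closedBall`); on the complement of all these events
and of `⋃ᵢ {‖wᵢ‖ ≥ Kℓ}` (probability `≤ Nσ`) one has `ξ(wᵢ) = wᵢ` and, for a unit `u'` with net
point `u`, `∑(⟨u', wᵢ⟩² - ⟨u, wᵢ⟩²) ≤ ∑ |⟨u' - u, wᵢ⟩| |⟨u' + u, wᵢ⟩| ≤ N · 2ε(Kℓ)² = Nℓ²`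
(`sum_inner_sq_le_of_net`), whence `∑ ⟨u', wᵢ⟩² ≤ 3Nℓ²`. (The regime `K² ≤ 3`, where the net
count `(2K²√n + 2)ⁿ ≤ (4K²√n)ⁿ` could fail, is trivial: short samples give `∑ ⟨u, wᵢ⟩² ≤ NK²ℓ²‖u‖²`
outright, `sum_inner_sq_le_of_norm_lt`; and `n = 0` has no nonzero `u`.)

## References

* D. Micciancio, O. Regev, *Worst-case to average-case reductions based on Gaussian measures*,
  SIAM J. Comput. 37 (2007) 267–302; authors' version, eq. (14) and Lemma 5.20 (p. 27), App. A
  (pp. 33–34) (`lit read doi:10.1137/S0097539705447360`).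
* D. Aharonov, O. Regev, *Lattice problems in NP ∩ coNP*, J. ACM 52 (2005) 749–765, Lemma 6.2.
* W. Hoeffding, *Probability inequalities for sums of bounded random variables*, JASA 58 (1963).
-/

noncomputable section

open Finset Metric Module
open scoped InnerProductSpace RealInnerProductSpace

namespace Literature.Probability.Moments

section Perturb

variable {V : Type*} [NormedAddCommGroup V] [InnerProductSpace ℝ V] {ι : Type*} [Fintype ι]

/-- Squares of inner products are bounded by products of squared norms. [folklore] -/
theorem inner_sq_le_norm_mul_sq (u x : V) : ⟪u, x⟫ ^ 2 ≤ (‖u‖ * ‖x‖) ^ 2 :=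
  sq_le_sq' (by linarith [abs_le.1 (abs_real_inner_le_norm u x), norm_nonneg u, norm_nonneg x])
    ((le_abs_self _).trans (abs_real_inner_le_norm u x))

/-- **From the net to all vectors** (deterministic half of MR07 Lemma 5.20, App. A p. 34): if every
point `a` of an `ε`-net `A` of the unit ball (`ε = 1/(2K²)`, points of norm `≤ 1`) satisfies
`∑ᵢ ⟨a, wᵢ⟩² ≤ 2Nℓ²` and all `‖wᵢ‖ ≤ Kℓ`, then `∑ᵢ ⟨u, wᵢ⟩² ≤ 3Nℓ²‖u‖²` for EVERY `u` — i.e. the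
largest eigenvalue of `W Wᵀ` is at most `3Nℓ²`. Printed step: for a unit `u'` and its net point `u`,
`|N⁻¹∑(⟨u', ξᵢ⟩² - ⟨u, ξᵢ⟩²)| ≤ N⁻¹∑|⟨u' - u, ξᵢ⟩⟨u' + u, ξᵢ⟩| ≤ 2ε(Kℓ)² = ℓ²`.
[cite: MicciancioRegev2007, Lemma 5.20 (proof, App. A p. 34)] -/
theorem sum_inner_sq_le_of_net {A : Finset V} {ε K ℓ : ℝ} (hK : 0 < K) (hℓ : 0 ≤ ℓ)
    (hε : ε = 1 / (2 * K ^ 2)) (hA1 : ∀ a ∈ A, ‖a‖ ≤ 1)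
    (hAnet : ∀ x : V, ‖x‖ ≤ 1 → ∃ a ∈ A, ‖a - x‖ ≤ ε) {w : ι → V}
    (hgood : ∀ a ∈ A, ∑ i, ⟪a, w i⟫ ^ 2 ≤ 2 * Fintype.card ι * ℓ ^ 2)
    (hnorm : ∀ i, ‖w i‖ ≤ K * ℓ) (u : V) :
    ∑ i, ⟪u, w i⟫ ^ 2 ≤ 3 * Fintype.card ι * ℓ ^ 2 * ‖u‖ ^ 2 := by
  set N : ℝ := (Fintype.card ι : ℝ) with hN
  have hε0 : 0 ≤ ε := by rw [hε]; positivity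
  -- unit vectors first
  have key : ∀ x : V, ‖x‖ = 1 → ∑ i, ⟪x, w i⟫ ^ 2 ≤ 3 * N * ℓ ^ 2 := by
    intro x hx
    obtain ⟨a, ha, hax⟩ := hAnet x hx.le
    have hterm : ∀ i, ⟪x, w i⟫ ^ 2 - ⟪a, w i⟫ ^ 2 ≤ ℓ ^ 2 := by
      intro i
      have h1 : |⟪x - a, w i⟫| ≤ ε * (K * ℓ) := by
        calc |⟪x - a, w i⟫| ≤ ‖x - a‖ * ‖w i‖ := abs_real_inner_le_norm _ _
          _ ≤ ε * (K * ℓ) := by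
              gcongr
              · rw [← norm_neg, neg_sub]; exact hax
              · exact hnorm i
      have h2 : |⟪x + a, w i⟫| ≤ 2 * (K * ℓ) := by
        calc |⟪x + a, w i⟫| ≤ ‖x + a‖ * ‖w i‖ := abs_real_inner_le_norm _ _
          _ ≤ (‖x‖ + ‖a‖) * ‖w i‖ := by gcongr; exact norm_add_le _ _
          _ ≤ (1 + 1) * (K * ℓ) := by gcongr <;> [exact hx.le; exact hA1 a ha; exact hnorm i]
          _ = 2 * (K * ℓ) := by ring
      have hprod : ⟪x, w i⟫ ^ 2 - ⟪a, w i⟫ ^ 2 = ⟪x - a, w i⟫ * ⟪x + a, w i⟫ := by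
        rw [inner_sub_left, inner_add_left]; ring
      rw [hprod]
      calc ⟪x - a, w i⟫ * ⟪x + a, w i⟫ ≤ |⟪x - a, w i⟫ * ⟪x + a, w i⟫| := le_abs_self _
        _ = |⟪x - a, w i⟫| * |⟪x + a, w i⟫| := abs_mul _ _
        _ ≤ (ε * (K * ℓ)) * (2 * (K * ℓ)) := by gcongr
        _ = ℓ ^ 2 := by rw [hε]; field_simp
    calc ∑ i, ⟪x, w i⟫ ^ 2 = ∑ i, (⟪a, w i⟫ ^ 2 + (⟪x, w i⟫ ^ 2 - ⟪a, w i⟫ ^ 2)) := by simp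
      _ = ∑ i, ⟪a, w i⟫ ^ 2 + ∑ i, (⟪x, w i⟫ ^ 2 - ⟪a, w i⟫ ^ 2) := Finset.sum_add_distrib
      _ ≤ 2 * N * ℓ ^ 2 + ∑ _i : ι, ℓ ^ 2 := add_le_add (hgood a ha) (Finset.sum_le_sum fun i _ => hterm i)
      _ = 3 * N * ℓ ^ 2 := by rw [Finset.sum_const, Finset.card_univ, nsmul_eq_mul, ← hN]; ring
  -- general `u`: scale
  by_cases hu : u = 0
  · subst hu
    simp
  · have hne : ‖u‖ ≠ 0 := norm_ne_zero_iff.2 hu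
    have hunit : ‖‖u‖⁻¹ • u‖ = 1 := by rw [norm_smul, norm_inv, norm_norm, inv_mul_cancel₀ hne]
    have hi : ∀ i, ⟪u, w i⟫ = ‖u‖ * ⟪‖u‖⁻¹ • u, w i⟫ := fun i => by
      rw [real_inner_smul_left, ← mul_assoc, mul_inv_cancel₀ hne, one_mul]
    calc ∑ i, ⟪u, w i⟫ ^ 2 = ‖u‖ ^ 2 * ∑ i, ⟪‖u‖⁻¹ • u, w i⟫ ^ 2 := by
          rw [Finset.mul_sum]
          exact Finset.sum_congr rfl fun i _ => by rw [hi i]; ring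
      _ ≤ ‖u‖ ^ 2 * (3 * N * ℓ ^ 2) := by gcongr; exact key _ hunit
      _ = 3 * N * ℓ ^ 2 * ‖u‖ ^ 2 := by ring

/-- The trivial regime `K² ≤ 3`: if all `‖wᵢ‖ < Kℓ` then `∑ᵢ ⟨u, wᵢ⟩² ≤ N K²ℓ²‖u‖² ≤ 3Nℓ²‖u‖²`.
[folklore] -/
theorem sum_inner_sq_le_of_norm_lt {K ℓ : ℝ} (hK3 : K ^ 2 ≤ 3) {w : ι → V}
    (hnorm : ∀ i, ‖w i‖ < K * ℓ) (u : V) :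
    ∑ i, ⟪u, w i⟫ ^ 2 ≤ 3 * Fintype.card ι * ℓ ^ 2 * ‖u‖ ^ 2 := by
  calc ∑ i, ⟪u, w i⟫ ^ 2 ≤ ∑ _i : ι, ‖u‖ ^ 2 * (K * ℓ) ^ 2 := Finset.sum_le_sum fun i _ => by
        calc ⟪u, w i⟫ ^ 2 ≤ (‖u‖ * ‖w i‖) ^ 2 := inner_sq_le_norm_mul_sq u (w i)
          _ ≤ (‖u‖ * (K * ℓ)) ^ 2 := by
              gcongr
              exact (hnorm i).le
          _ = ‖u‖ ^ 2 * (K * ℓ) ^ 2 := by ring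
    _ = Fintype.card ι * (‖u‖ ^ 2 * (K * ℓ) ^ 2) := by
        rw [Finset.sum_const, Finset.card_univ, nsmul_eq_mul]
    _ ≤ 3 * Fintype.card ι * ℓ ^ 2 * ‖u‖ ^ 2 := by
        have h0 : 0 ≤ (Fintype.card ι : ℝ) * ‖u‖ ^ 2 * ℓ ^ 2 := by positivity
        nlinarith

end Perturb

section Random

open MeasureTheory ProbabilityTheory
open scoped NNReal

variable {Ω : Type*} [MeasurableSpace Ω] {P : Measure Ω} [IsProbabilityMeasure P]
variable {V : Type*} [NormedAddCommGroup V] [InnerProductSpace ℝ V] [MeasurableSpace V] [BorelSpace V]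
variable {ι : Type*} [Fintype ι]

omit [IsProbabilityMeasure P] [MeasurableSpace V] [BorelSpace V] in
/-- Second moments of projections scale: if `E⟨u, w⟩² ≤ ℓ²` for unit `u` and `w` has finite second
moments, then `E⟨u, w⟩² ≤ ℓ²` for every `u` with `‖u‖ ≤ 1`, and `⟨u, w⟩²` is integrable. [folklore] -/
theorem integral_inner_sq_le_of_norm_le_one {w : Ω → V} (hL2 : MemLp w 2 P) {ℓ : ℝ}
    (h2 : ∀ u : V, ‖u‖ = 1 → ∫ ω, ⟪u, w ω⟫ ^ 2 ∂P ≤ ℓ ^ 2) {u : V} (hu : ‖u‖ ≤ 1) :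
    Integrable (fun ω => ⟪u, w ω⟫ ^ 2) P ∧ ∫ ω, ⟪u, w ω⟫ ^ 2 ∂P ≤ ℓ ^ 2 := by
  have hint : ∀ v : V, Integrable (fun ω => ⟪v, w ω⟫ ^ 2) P := fun v => by
    have hn := (memLp_two_iff_integrable_sq_norm hL2.aestronglyMeasurable).1 hL2
    refine (hn.const_mul (‖v‖ ^ 2)).mono' ?_ (ae_of_all _ fun ω => ?_)
    · exact ((continuous_const.inner continuous_id).pow 2).comp_aestronglyMeasurable
        hL2.aestronglyMeasurable
    · rw [Real.norm_eq_abs, abs_of_nonneg (sq_nonneg _), ← mul_pow]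
      exact inner_sq_le_norm_mul_sq v (w ω)
  refine ⟨hint u, ?_⟩
  by_cases hu0 : u = 0
  · subst hu0
    simp only [inner_zero_left, ne_eq, OfNat.ofNat_ne_zero, not_false_eq_true, zero_pow,
      integral_zero]
    positivity
  · have hne : ‖u‖ ≠ 0 := norm_ne_zero_iff.2 hu0
    have hv : ‖‖u‖⁻¹ • u‖ = 1 := by rw [norm_smul, norm_inv, norm_norm, inv_mul_cancel₀ hne]
    have hrew : ∀ ω, ⟪u, w ω⟫ ^ 2 = ‖u‖ ^ 2 * ⟪‖u‖⁻¹ • u, w ω⟫ ^ 2 := fun ω => by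
      rw [real_inner_smul_left, mul_pow, ← mul_assoc, ← mul_pow, mul_inv_cancel₀ hne, one_pow,
        one_mul]
    simp_rw [hrew]
    rw [integral_const_mul]
    calc ‖u‖ ^ 2 * ∫ ω, ⟪‖u‖⁻¹ • u, w ω⟫ ^ 2 ∂P ≤ 1 * ℓ ^ 2 :=
          mul_le_mul (pow_le_one₀ (norm_nonneg _) hu) (h2 _ hv)
            (integral_nonneg fun ω => sq_nonneg _) zero_le_one
      _ = ℓ ^ 2 := one_mul _

/-- **Hoeffding step of MR07 Lemma 5.20** (App. A p. 33, eq. (21)): for a fixed `u` with `‖u‖ ≤ 1`,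
independent samples `wᵢ` with `E⟨u, wᵢ⟩² ≤ ℓ²` (unit `u`) and the truncation
`ξ(x) = x` if `‖x‖ ≤ Kℓ`, `ξ(x) = 0` otherwise (Mathlib: the indicator of the closed ball), the
variables `⟨u, ξ(wᵢ)⟩² ∈ [0, (Kℓ)²]` have mean `≤ ℓ²`, so by Hoeffding's inequality
`Pr[∑ᵢ ⟨u, ξ(wᵢ)⟩² > 2Nℓ²] ≤ e^{-2N/K⁴}` (print: `≤ e^{-N/K⁴}`).
[cite: MicciancioRegev2007, Lemma 5.20 (proof, App. A p. 33, eq. (21))] -/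
theorem measureReal_lt_sum_inner_indicator_sq_le {w : ι → Ω → V} (hind : iIndepFun w P)
    (hL2 : ∀ i, MemLp (w i) 2 P) {ℓ K : ℝ} (hℓ : 0 < ℓ) (hK : 0 < K)
    (h2 : ∀ i (u : V), ‖u‖ = 1 → ∫ ω, ⟪u, w i ω⟫ ^ 2 ∂P ≤ ℓ ^ 2) {u : V} (hu : ‖u‖ ≤ 1) :
    P.real {ω | 2 * Fintype.card ι * ℓ ^ 2 <
        ∑ i, ⟪u, (Metric.closedBall (0 : V) (K * ℓ)).indicator id (w i ω)⟫ ^ 2} ≤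
      Real.exp (-(2 * Fintype.card ι / K ^ 4)) := by
  classical
  set N : ℕ := Fintype.card ι with hN
  set R : ℝ := K * ℓ with hR
  have hR0 : 0 < R := by positivity
  set T : V → V := (Metric.closedBall (0 : V) R).indicator id with hT
  set φ : V → ℝ := fun x => ⟪u, T x⟫ ^ 2 with hφ
  have hTmeas : Measurable T := measurable_id.indicator Metric.isClosed_closedBall.measurableSet
  have hφmeas : Measurable φ :=
    ((continuous_const.inner continuous_id).pow 2).measurable.comp hTmeas
  have hTnorm : ∀ x, ‖T x‖ ≤ R := fun x => by
    by_cases hx : x ∈ Metric.closedBall (0 : V) R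
    · rw [hT, Set.indicator_of_mem hx, id]
      exact mem_closedBall_zero_iff.1 hx
    · rw [hT, Set.indicator_of_notMem hx, norm_zero]
      exact hR0.le
  have hφbound : ∀ x, φ x ∈ Set.Icc 0 (R ^ 2) := fun x => by
    refine ⟨sq_nonneg _, ?_⟩
    calc ⟪u, T x⟫ ^ 2 ≤ (‖u‖ * ‖T x‖) ^ 2 := inner_sq_le_norm_mul_sq u (T x)
      _ ≤ (1 * R) ^ 2 :=
          pow_le_pow_left₀ (by positivity) (mul_le_mul hu (hTnorm x) (norm_nonneg _) zero_le_one) 2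
      _ = R ^ 2 := by ring
  have hφle : ∀ x, φ x ≤ ⟪u, x⟫ ^ 2 := fun x => by
    by_cases hx : x ∈ Metric.closedBall (0 : V) R
    · simp only [hφ, hT, Set.indicator_of_mem hx, id, le_refl]
    · simp only [hφ, hT, Set.indicator_of_notMem hx, inner_zero_right, ne_eq, OfNat.ofNat_ne_zero,
        not_false_eq_true, zero_pow]
      exact sq_nonneg _
  -- the truncated squared projections `Xᵢ = φ ∘ wᵢ` and their means
  set X : ι → Ω → ℝ := fun i ω => φ (w i ω) with hX
  have hXmeas : ∀ i, AEMeasurable (X i) P := fun i =>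
    hφmeas.comp_aemeasurable (hL2 i).aestronglyMeasurable.aemeasurable
  have hXint : ∀ i, Integrable (X i) P := fun i =>
    Integrable.of_mem_Icc 0 (R ^ 2) (hXmeas i) (ae_of_all _ fun ω => hφbound _)
  have hEX : ∀ i, ∫ ω, X i ω ∂P ≤ ℓ ^ 2 := fun i => by
    obtain ⟨hint2, hle⟩ := integral_inner_sq_le_of_norm_le_one (hL2 i) (h2 i) hu
    exact (integral_mono (hXint i) hint2 fun ω => hφle _).trans hle
  -- Hoeffding: centred bounded variables are sub-Gaussian, and they are independent
  set c : ℝ≥0 := (‖R ^ 2 - 0‖₊ / 2) ^ 2 with hc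
  have hsubG : ∀ i, HasSubgaussianMGF (fun ω => X i ω - ∫ ω', X i ω' ∂P) c P := fun i =>
    hasSubgaussianMGF_of_mem_Icc (hXmeas i) (ae_of_all _ fun ω => hφbound _)
  have hindY : iIndepFun (fun i ω => X i ω - ∫ ω', X i ω' ∂P) P :=
    hind.comp (fun i x => φ x - ∫ ω', X i ω' ∂P) fun i => hφmeas.sub_const _
  have hHoeff := HasSubgaussianMGF.measure_sum_ge_le_of_iIndepFun hindY (c := fun _ => c)
    (s := Finset.univ) (fun i _ => hsubG i) (ε := N * ℓ ^ 2) (by positivity)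
  -- the event
  have hsub : {ω | 2 * (N : ℝ) * ℓ ^ 2 < ∑ i, ⟪u, T (w i ω)⟫ ^ 2} ⊆
      {ω | (N : ℝ) * ℓ ^ 2 ≤ ∑ i ∈ Finset.univ, (X i ω - ∫ ω', X i ω' ∂P)} := by
    intro ω hω
    simp only [Set.mem_setOf_eq] at hω ⊢
    rw [Finset.sum_sub_distrib]
    have hsumE : ∑ i, ∫ ω', X i ω' ∂P ≤ N * ℓ ^ 2 := by
      calc ∑ i, ∫ ω', X i ω' ∂P ≤ ∑ _i : ι, ℓ ^ 2 := Finset.sum_le_sum fun i _ => hEX i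
        _ = N * ℓ ^ 2 := by rw [Finset.sum_const, Finset.card_univ, nsmul_eq_mul]
    have : ∑ i, X i ω = ∑ i, ⟪u, T (w i ω)⟫ ^ 2 := rfl
    linarith
  rcases Nat.eq_zero_or_pos N with hN0 | hNpos
  · -- no samples: the event is empty
    have : {ω | 2 * (N : ℝ) * ℓ ^ 2 < ∑ i, ⟪u, T (w i ω)⟫ ^ 2} = ∅ := by
      ext ω
      simp only [Set.mem_setOf_eq, Set.mem_empty_iff_false, iff_false, not_lt]
      have hι : IsEmpty ι := Fintype.card_eq_zero_iff.1 hN0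
      simp [hN0]
    rw [this, measureReal_empty]
    positivity
  calc P.real {ω | 2 * (N : ℝ) * ℓ ^ 2 < ∑ i, ⟪u, T (w i ω)⟫ ^ 2}
      ≤ P.real {ω | (N : ℝ) * ℓ ^ 2 ≤ ∑ i ∈ Finset.univ, (X i ω - ∫ ω', X i ω' ∂P)} :=
        measureReal_mono hsub
    _ ≤ Real.exp (-((N : ℝ) * ℓ ^ 2) ^ 2 / (2 * ∑ _i ∈ (Finset.univ : Finset ι), (c : ℝ))) := by
        convert hHoeff using 2
        push_cast
        rfl
    _ = Real.exp (-(2 * N / K ^ 4)) := by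
        congr 1
        have hcR : (c : ℝ) = (R ^ 2 / 2) ^ 2 := by
          rw [hc]
          push_cast
          rw [sub_zero, Real.norm_eq_abs, abs_of_nonneg (sq_nonneg _)]
        rw [Finset.sum_const, Finset.card_univ, ← hN, nsmul_eq_mul, hcR, hR]
        have hN' : (0 : ℝ) < N := by exact_mod_cast hNpos
        field_simp

/-- **Micciancio–Regev 2007, Lemma 5.20** (= Aharonov–Regev 2005, Lemma 6.2): let `w₁, …, w_N` be
independent random vectors in an `n`-dimensional real inner product space, with finite second
moments, such that for every unit vector `u` and every `i`, `E[⟨u, wᵢ⟩²] ≤ ℓ²` and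
`Pr[‖wᵢ‖ ≥ Kℓ] ≤ σ`. Then, except with probability at most `e^{-N/K⁴} (4√n K²)ⁿ + Nσ`, the
largest eigenvalue of `W Wᵀ` is at most `3Nℓ²`, i.e. `∑ᵢ ⟨u, wᵢ⟩² ≤ 3Nℓ²‖u‖²` for all `u`
simultaneously (stated as a bound on the outer probability of the complementary event, which needs
no measurability). The printed statement has the `wᵢ` i.i.d. from one distribution `D`; only
independence and the two per-sample bounds are used. Proof as printed (App. A, pp. 33–34):
truncation at `Kℓ`, Hoeffding for each point of an `ε`-net of the sphere (`ε = 1/(2K²)`, net of size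
`≤ (2√n/ε)ⁿ` from the cubic grid), union bound, perturbation from the net to all unit vectors, and
`Pr[some ‖wᵢ‖ ≥ Kℓ] ≤ Nσ`. [cite: MicciancioRegev2007, Lemma 5.20 (authors' version p. 27, proof App. A pp. 33–34)] -/
theorem MicciancioRegev2007.measureReal_exists_lt_sum_inner_sq_le [FiniteDimensional ℝ V]
    {w : ι → Ω → V} (hind : iIndepFun w P) (hL2 : ∀ i, MemLp (w i) 2 P) {ℓ K σ : ℝ}
    (hℓ : 0 < ℓ) (hK : 0 < K) (h2 : ∀ i (u : V), ‖u‖ = 1 → ∫ ω, ⟪u, w i ω⟫ ^ 2 ∂P ≤ ℓ ^ 2)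
    (htail : ∀ i, P.real {ω | K * ℓ ≤ ‖w i ω‖} ≤ σ) :
    P.real {ω | ∃ u : V, 3 * Fintype.card ι * ℓ ^ 2 * ‖u‖ ^ 2 < ∑ i, ⟪u, w i ω⟫ ^ 2} ≤
      Real.exp (-(Fintype.card ι / K ^ 4)) * (4 * Real.sqrt (finrank ℝ V) * K ^ 2) ^ finrank ℝ V
        + Fintype.card ι * σ := by
  classical
  set N : ℕ := Fintype.card ι with hN
  set n : ℕ := finrank ℝ V with hn
  set bad : Set Ω := {ω | ∃ u : V, 3 * (N : ℝ) * ℓ ^ 2 * ‖u‖ ^ 2 < ∑ i, ⟪u, w i ω⟫ ^ 2} with hbad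
  set tail : ι → Set Ω := fun i => {ω | K * ℓ ≤ ‖w i ω‖} with htl
  have hσ : 0 ≤ (N : ℝ) * σ := by
    rcases isEmpty_or_nonempty ι with hι | ⟨⟨i⟩⟩
    · simp [hN, Fintype.card_eq_zero]
    · exact mul_nonneg (Nat.cast_nonneg _) (measureReal_nonneg.trans (htail i))
  have hmain : 0 ≤ Real.exp (-((N : ℝ) / K ^ 4)) * (4 * Real.sqrt n * K ^ 2) ^ n := by positivity
  have htails : P.real (⋃ i, tail i) ≤ N * σ := by
    refine (measureReal_iUnion_fintype_le _).trans ?_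
    calc ∑ i, P.real (tail i) ≤ ∑ _i : ι, σ := Finset.sum_le_sum fun i _ => htail i
      _ = N * σ := by rw [Finset.sum_const, Finset.card_univ, nsmul_eq_mul]
  by_cases hK3 : K ^ 2 ≤ 3
  · -- trivial regime: short samples cannot violate the bound
    have hsub : bad ⊆ ⋃ i, tail i := by
      rintro ω ⟨u, hu⟩
      by_contra hcon
      simp only [Set.mem_iUnion, not_exists, htl, Set.mem_setOf_eq, not_le] at hcon
      exact absurd (sum_inner_sq_le_of_norm_lt hK3 hcon u) (not_le.2 hu)
    calc P.real bad ≤ P.real (⋃ i, tail i) := measureReal_mono hsub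
      _ ≤ N * σ := htails
      _ ≤ _ := le_add_of_nonneg_left hmain
  push Not at hK3
  rcases Nat.eq_zero_or_pos n with hn0 | hnpos
  · -- zero-dimensional space: no nonzero `u`
    have hV : ∀ u : V, u = 0 := finrank_zero_iff_forall_zero.1 hn0
    have hempty : bad = ∅ := Set.eq_empty_iff_forall_notMem.2 fun ω ⟨u, hu⟩ => by
      rw [hV u] at hu
      simp at hu
    rw [hempty, measureReal_empty]
    positivity
  -- the net
  set ε : ℝ := 1 / (2 * K ^ 2) with hε
  obtain ⟨A, hA1, hAcard, hAnet⟩ :=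
    Literature.Analysis.Convexity.exists_net_closedBall (V := V) (by positivity : 0 < ε) hnpos
  set T : V → V := (Metric.closedBall (0 : V) (K * ℓ)).indicator id with hT
  set badu : V → Set Ω := fun u => {ω | 2 * (N : ℝ) * ℓ ^ 2 < ∑ i, ⟪u, T (w i ω)⟫ ^ 2} with hbu
  have hsub : bad ⊆ (⋃ u ∈ A, badu u) ∪ ⋃ i, tail i := by
    rintro ω ⟨u, hu⟩
    by_contra hcon
    simp only [Set.mem_union, Set.mem_iUnion, not_or, not_exists, exists_prop, not_and] at hcon
    obtain ⟨hA', htail'⟩ := hcon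
    have hnorm : ∀ i, ‖w i ω‖ ≤ K * ℓ := fun i => by
      have := htail' i
      simp only [htl, Set.mem_setOf_eq, not_le] at this
      exact this.le
    have hTw : ∀ i, T (w i ω) = w i ω := fun i => by
      rw [hT, Set.indicator_of_mem (mem_closedBall_zero_iff.2 (hnorm i)), id]
    have hgood : ∀ a ∈ A, ∑ i, ⟪a, w i ω⟫ ^ 2 ≤ 2 * N * ℓ ^ 2 := fun a ha => by
      have := hA' a ha
      simp only [hbu, Set.mem_setOf_eq, not_lt, hTw] at this
      exact this
    exact absurd (sum_inner_sq_le_of_net hK hℓ.le hε hA1 hAnet hgood hnorm u) (not_le.2 hu)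
  have hone : (1 : ℝ) ≤ Real.sqrt n := by
    rw [Real.one_le_sqrt]
    exact_mod_cast hnpos
  calc P.real bad ≤ P.real ((⋃ u ∈ A, badu u) ∪ ⋃ i, tail i) := measureReal_mono hsub
    _ ≤ P.real (⋃ u ∈ A, badu u) + P.real (⋃ i, tail i) := measureReal_union_le _ _
    _ ≤ ∑ u ∈ A, P.real (badu u) + N * σ :=
        add_le_add (measureReal_biUnion_finset_le _ _) htails
    _ ≤ ∑ _u ∈ A, Real.exp (-(2 * N / K ^ 4)) + N * σ := by
        gcongr with u hu
        exact measureReal_lt_sum_inner_indicator_sq_le hind hL2 hℓ hK h2 (hA1 u hu)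
    _ = A.card * Real.exp (-(2 * N / K ^ 4)) + N * σ := by
        rw [Finset.sum_const, nsmul_eq_mul]
    _ ≤ (4 * Real.sqrt n * K ^ 2) ^ n * Real.exp (-(N / K ^ 4)) + N * σ := by
        gcongr
        · calc (A.card : ℝ) ≤ (Real.sqrt n / ε + 2) ^ n := hAcard
            _ ≤ (4 * Real.sqrt n * K ^ 2) ^ n := by
                refine pow_le_pow_left₀ (by positivity) ?_ n
                have hεn : Real.sqrt n / ε = 2 * K ^ 2 * Real.sqrt n := by
                  rw [hε]; field_simp
                rw [hεn]
                nlinarith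
        · linarith [Nat.cast_nonneg (α := ℝ) N]
    _ = _ := by ring

/-- **MR07 Lemma 5.20, positive form**: with probability at least
`1 - e^{-N/K⁴}(4√n K²)ⁿ - Nσ`, `∑ᵢ ⟨u, wᵢ⟩² ≤ 3Nℓ²‖u‖²` for all `u` simultaneously (largest
eigenvalue of `W Wᵀ` at most `3Nℓ²`); by subadditivity of the outer measure, no measurability is
needed. [cite: MicciancioRegev2007, Lemma 5.20 (authors' version p. 27)] -/
theorem MicciancioRegev2007.one_sub_le_measureReal_forall_sum_inner_sq_le [FiniteDimensional ℝ V]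
    {w : ι → Ω → V} (hind : iIndepFun w P) (hL2 : ∀ i, MemLp (w i) 2 P) {ℓ K σ : ℝ}
    (hℓ : 0 < ℓ) (hK : 0 < K) (h2 : ∀ i (u : V), ‖u‖ = 1 → ∫ ω, ⟪u, w i ω⟫ ^ 2 ∂P ≤ ℓ ^ 2)
    (htail : ∀ i, P.real {ω | K * ℓ ≤ ‖w i ω‖} ≤ σ) :
    1 - (Real.exp (-(Fintype.card ι / K ^ 4)) * (4 * Real.sqrt (finrank ℝ V) * K ^ 2) ^ finrank ℝ V
        + Fintype.card ι * σ) ≤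
      P.real {ω | ∀ u : V, ∑ i, ⟪u, w i ω⟫ ^ 2 ≤ 3 * Fintype.card ι * ℓ ^ 2 * ‖u‖ ^ 2} := by
  have hbad := MicciancioRegev2007.measureReal_exists_lt_sum_inner_sq_le hind hL2 hℓ hK h2 htail
  have hunion : (Set.univ : Set Ω) ⊆
      {ω | ∀ u : V, ∑ i, ⟪u, w i ω⟫ ^ 2 ≤ 3 * Fintype.card ι * ℓ ^ 2 * ‖u‖ ^ 2} ∪
        {ω | ∃ u : V, 3 * Fintype.card ι * ℓ ^ 2 * ‖u‖ ^ 2 < ∑ i, ⟪u, w i ω⟫ ^ 2} := by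
    intro ω _
    by_cases h : ∀ u : V, ∑ i, ⟪u, w i ω⟫ ^ 2 ≤ 3 * Fintype.card ι * ℓ ^ 2 * ‖u‖ ^ 2
    · exact Or.inl h
    · push Not at h
      exact Or.inr h
  have h1 : (1 : ℝ) ≤ P.real {ω | ∀ u : V, ∑ i, ⟪u, w i ω⟫ ^ 2 ≤ 3 * Fintype.card ι * ℓ ^ 2 * ‖u‖ ^ 2} +
      P.real {ω | ∃ u : V, 3 * Fintype.card ι * ℓ ^ 2 * ‖u‖ ^ 2 < ∑ i, ⟪u, w i ω⟫ ^ 2} := by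
    calc (1 : ℝ) = P.real Set.univ := by simp
      _ ≤ _ := (measureReal_mono hunion).trans (measureReal_union_le _ _)
  linarith

end Random


end Literature.Probability.Moments

end
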